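import Literature.AlgebraicGeometry.ModuliOfAbelianVarieties.SiegelFineModuliScheme                -- ★ `SiegelFineModuliScheme.classifyingMap`, `exists_isBaseChangeVia_classifyingMap`
import Literature.AlgebraicGeometry.AbelianSchemes.TupleIsoPointCriteria                           -- ★ `exists_iso_of_tupleRel_id` (BRIDGE `(G, Ĝ)` ⇒ honest iso, reduced loc. Noetherian base)
import Literature.AlgebraicGeometry.AbelianSchemes.PolarizedAbelianSchemeWithLevelBaseChangeUnique   -- ★ `IsBaseChangeVia.exists_isBaseChangeVia_id` (uniqueness)
import Literature.AlgebraicGeometry.AbelianSchemes.PolarizedAbelianSchemeWithLevelBaseChange         -- ★ `PolarizedAbelianSchemeWithLevel.baseChange`, `baseChange_isBaseChangeVia`, `IsBaseChangeVia.trans`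
import HarnessLib

/-!
# Fine moduli: a triple whose classifying map FACTORS as `g ≫ f` is isomorphic — as a triple, by an isomorphism of group schemes exact on `λ` and on
# the level sections — to the pull-back `(univ ×_M f) ×_X g` ([MumfordFogartyKirwan1994] Ch. 7 §2 Def. 7.2–7.3, §3 Thm. 7.9; [GortzWedhorn2020] Prop. 4.16)

Topic `AlgebraicGeometry/ModuliOfAbelianVarieties`; namespace `Literature.AlgebraicGeometry.ModuliOfAbelianVarieties.SiegelFineModuliScheme`.  THEOREMS ONLY (no
definition, no instance, no notation, no named fact, no `sorry`).  Cell `hodgecm-mathlib` (D-0151), P6 «MOD», crux hLiu418 (stmt-HodgeConjecture-24832, `--supports`,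
count-neutral): the FINE-MODULI STEP of LEG-E(γ′) GLOBAL GLUE for the (S8) closer `Lines/F0_P6a_StubESHEET.lean` (socket `hole_SHEET_global`, LA7-p01 (g4)) — there
`T` is the Serre-twisted tuple `P ⊗ 𝔞⁻¹` over `X = (M_Kc) ⊗_F Fᵢ`, `f = ε ≫ pr₁` the chart slice, `g = 1 × Spec γ`, and `g ≫ f = classifyingMap T` is LEG-C.
HONEST LABEL: HC_CM is proved only modulo the printed citations (2 remaining named inputs hLiu418 24832, h413 24833) until rung 0 closes; this file is generic.

THE MATHEMATICS.  Let `𝓜` be a fine moduli scheme over `ℚ` with universal triple `univ` ([MumfordFogartyKirwan1994] Thm. 7.9), `X` a locally Noetherian `ℚ`-scheme,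
`T` a triple over `X`, `f : X → 𝓜.M` and `g : X → X`.  If the classifying map of `T` is `g ≫ f`, then `T` and `(univ ×_𝓜 f) ×_X g` are both pull-backs of `univ`
along `g ≫ f` (`classify`; ★ `baseChange_isBaseChangeVia` twice, composed), hence related along `𝟙 X` by the comparison isomorphisms of the cartesian squares
(★ `IsBaseChangeVia.exists_isBaseChangeVia_id`, Def. 7.2: «all up to isomorphism»); over a REDUCED locally Noetherian `X` the bridge ★ `exists_iso_of_tupleRel_id`
turns the relation into an isomorphism of group schemes `E : T.A ≅ (univ ×_𝓜 f) ×_X g` with `E ≫ λ′ ≫ E^∨ = λ_T` and `η_T ≫ E = η′` — no connectedness of `X` needed.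
* §1 **`SiegelFineModuliScheme.exists_iso_baseChange_of_comp_eq_classifyingMap`**; ED. 2 (append-only): the unpackaged-base twin
  **`…_mk`** (`X` a plain scheme with `pX : X → Spec ℚ`, read as `Over.mk pX`).

## References
* [MumfordFogartyKirwan1994] D. Mumford, J. Fogarty, F. Kirwan, *Geometric Invariant Theory*, 3rd ed. (1994), Ch. 7 §2 Definition 7.2 (p. 129), Definition 7.3 (p. 130),
  §3 Theorem 7.9 (p. 139).
* [GortzWedhorn2020] U. Görtz, T. Wedhorn, *Algebraic Geometry I*, 2nd ed. (2020), Prop. 4.16 (p. 101), Section (4.7) (pp. 107–108).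
* [MilneAV2008] J. S. Milne, *Abelian Varieties* (2008), I §8 pp. 36–37 (the dual isogeny of an isomorphism).
-/

set_option autoImplicit false

noncomputable section

open CategoryTheory CategoryTheory.Limits AlgebraicGeometry
open scoped MonObj

namespace Literature.AlgebraicGeometry.ModuliOfAbelianVarieties

namespace SiegelFineModuliScheme

open Literature.AlgebraicGeometry.Motives (SchemeOver)
open Literature.AlgebraicGeometry.AbelianSchemes (PolarizedAbelianSchemeWithLevel AbelianSchemeOver)

variable {g N : ℕ} {δ : Fin g → ℕ} (𝓜 : SiegelFineModuliScheme g N δ)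

set_option maxHeartbeats 400000 in
/-- **FINE MODULI ⇒ AN EXACT ISOMORPHISM OF TRIPLES FROM A FACTORED CLASSIFYING MAP.**  For a fine Siegel moduli scheme `𝓜` over `ℚ`, a `ℚ`-scheme `X` whose
underlying scheme is reduced and locally Noetherian, a triple `T` over `X`, and morphisms `f : X → 𝓜.M`, `gX : X → X` with `gX ≫ f = (classifyingMap X T).left`:
there is an isomorphism of group schemes `E : T.A ≅ ((𝓜.univ ×_𝓜 f) ×_X gX).A` over `X`, EXACT on the polarisations in dual-homomorphism form
(`E ≫ λ′ ≫ E^∨ = λ_T`) and carrying the level sections (`η_T,i ≫ E = η′_i`).  Proof: both triples are pull-backs of `univ` along `gX ≫ f` (★ `classify`, ★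
`baseChange_isBaseChangeVia` + `IsBaseChangeVia.trans`), hence related along `𝟙 X` (★ `exists_isBaseChangeVia_id`); the bridge ★ `exists_iso_of_tupleRel_id` (with
trivial `𝒪`-actions) gives `E`. [cite: MumfordFogartyKirwan1994, Ch. 7 §2 Definition 7.2 (p. 129), Definition 7.3 (p. 130) and §3 Theorem 7.9 (p. 139)]
[cite: GortzWedhorn2020, Prop. 4.16 (p. 101) and Section (4.7) (pp. 107–108)] [cite: MilneAV2008, I §8 pp. 36–37] -/
theorem exists_iso_baseChange_of_comp_eq_classifyingMap (X : SchemeOver ℚ) [IsLocallyNoetherian X.left] [IsReduced X.left]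
    (T : PolarizedAbelianSchemeWithLevel g N δ X.left) (f : X.left ⟶ 𝓜.M.left) (gX : X.left ⟶ X.left)
    (h : gX ≫ f = (𝓜.classifyingMap X T).left) :
    ∃ (E : T.A.X ≅ ((𝓜.univ.baseChange f).A.baseChange gX).X) (_ : IsMonHom E.hom),
      E.hom ≫ ((𝓜.univ.baseChange f).pol.baseChange gX).lam ≫
          AbelianSchemeOver.DualPair.dualIsogenyOver E.hom T.D ((𝓜.univ.baseChange f).D.baseChange gX) = T.pol.lam ∧
      ∀ i, T.level.σ i ≫ E.hom = ((𝓜.univ.baseChange f).level.baseChange gX).σ i := by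
  -- `T` is a pull-back of `univ` along its classifying map `= gX ≫ f`
  obtain ⟨G, Ĝ, hT⟩ := 𝓜.exists_isBaseChangeVia_classifyingMap X T
  rw [← h] at hT
  -- `(univ ×_𝓜 f) ×_X gX` is a pull-back of `univ` along `gX ≫ f`
  have hP : ((𝓜.univ.baseChange f).baseChange gX).IsBaseChangeVia 𝓜.univ (gX ≫ f) _ _ :=
    ((𝓜.univ.baseChange f).baseChange_isBaseChangeVia gX).trans (𝓜.univ.baseChange_isBaseChangeVia f)
  -- uniqueness: related along `𝟙 X`
  obtain ⟨H, Ĥ, hrel⟩ := PolarizedAbelianSchemeWithLevel.IsBaseChangeVia.exists_isBaseChangeVia_id hP hT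
  obtain ⟨hl, hh, hPc, hlam⟩ := hrel
  -- the bridge (trivial actions)
  obtain ⟨E, hmon, -, -, hElam, hEσ, -⟩ := AbelianSchemeOver.exists_iso_of_tupleRel_id T.D ((𝓜.univ.baseChange f).D.baseChange gX)
    T.pol.lam ((𝓜.univ.baseChange f).pol.baseChange gX).lam ((𝓜.univ.baseChange f).baseChange gX).hatNormalised T.level
    ((𝓜.univ.baseChange f).level.baseChange gX) (fun _ : Unit => 𝟙 _) (fun _ : Unit => 𝟙 _) ⟨hl, hh, hPc, hlam, fun _ => by simp⟩
  exact ⟨E, hmon, hElam, hEσ⟩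

/-- **UNPACKAGED-BASE FORM** (ED. 2, append-only): the same statement with the `ℚ`-scheme given as a plain scheme `X` and its structure morphism `pX`
(`X` read as `Over.mk pX`), so that a triple typed over `X` ITSELF and morphisms `f`, `gX` out of `X` are accepted without the caller unfolding `(Over.mk pX).left`
— the form consumed by LEG-E(γ′) of the (S8) closer, whose base `X = (M_Kc) ⊗_F Fᵢ` arrives as a pulled-back `Fᵢ`-scheme.  The instance for the test class of
`classify` is taken in the `(Over.mk pX).left` form (type-class search does not unfold `Over.mk`). [cite: MumfordFogartyKirwan1994, Ch. 7 §2 Definition 7.2 (p. 129), Definition 7.3 (p. 130) and §3 Theorem 7.9 (p. 139)]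
[cite: GortzWedhorn2020, Prop. 4.16 (p. 101) and Section (4.7) (pp. 107–108)] -/
theorem exists_iso_baseChange_of_comp_eq_classifyingMap_mk {X : Scheme.{0}} (pX : X ⟶ Spec (.of ℚ))
    [IsLocallyNoetherian (Over.mk pX : SchemeOver ℚ).left] [IsLocallyNoetherian X] [IsReduced X]
    (T : PolarizedAbelianSchemeWithLevel g N δ X) (f : X ⟶ 𝓜.M.left) (gX : X ⟶ X)
    (h : gX ≫ f = (𝓜.classifyingMap (Over.mk pX : SchemeOver ℚ) T).left) :
    ∃ (E : T.A.X ≅ ((𝓜.univ.baseChange f).A.baseChange gX).X) (_ : IsMonHom E.hom),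
      E.hom ≫ ((𝓜.univ.baseChange f).pol.baseChange gX).lam ≫
          AbelianSchemeOver.DualPair.dualIsogenyOver E.hom T.D ((𝓜.univ.baseChange f).D.baseChange gX) = T.pol.lam ∧
      ∀ i, T.level.σ i ≫ E.hom = ((𝓜.univ.baseChange f).level.baseChange gX).σ i := by
  -- `T` is a pull-back of `univ` along its classifying map `= gX ≫ f`
  obtain ⟨G, Ĝ, hT⟩ := 𝓜.exists_isBaseChangeVia_classifyingMap (Over.mk pX : SchemeOver ℚ) T
  rw [← h] at hT
  have hP : ((𝓜.univ.baseChange f).baseChange gX).IsBaseChangeVia 𝓜.univ (gX ≫ f) _ _ :=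
    ((𝓜.univ.baseChange f).baseChange_isBaseChangeVia gX).trans (𝓜.univ.baseChange_isBaseChangeVia f)
  obtain ⟨H, Ĥ, hrel⟩ := PolarizedAbelianSchemeWithLevel.IsBaseChangeVia.exists_isBaseChangeVia_id hP hT
  obtain ⟨hl, hh, hPc, hlam⟩ := hrel
  obtain ⟨E, hmon, -, -, hElam, hEσ, -⟩ := AbelianSchemeOver.exists_iso_of_tupleRel_id T.D ((𝓜.univ.baseChange f).D.baseChange gX)
    T.pol.lam ((𝓜.univ.baseChange f).pol.baseChange gX).lam ((𝓜.univ.baseChange f).baseChange gX).hatNormalised T.level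
    ((𝓜.univ.baseChange f).level.baseChange gX) (fun _ : Unit => 𝟙 _) (fun _ : Unit => 𝟙 _) ⟨hl, hh, hPc, hlam, fun _ => by simp⟩
  exact ⟨E, hmon, hElam, hEσ⟩

end SiegelFineModuliScheme

end Literature.AlgebraicGeometry.ModuliOfAbelianVarieties

end
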